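import Literature.NumberTheory.LFunctions.MertensConjectureDisproofCertificate
import Literature.NumberTheory.LFunctions.HardyZSignCertificate
import Mathlib.Analysis.Calculus.MeanValue
import HarnessLib

/-!
# Disproof of the Mertens conjecture: the certificate assembled (arithmetic hypotheses only)

Topic `Literature/NumberTheory/LFunctions` (summit `RiemannHypothesis`, inventory id rh.S22).
This file assembles proved interfaces of the tree into single statements all of whose hypotheses
are dischargeable by validated arithmetic (enclosures of `ζ`, `ζ'` at finitely many points and
boxes — `ZetaCertifiedEvaluation.lean` —, of `log`, `π`, `cos`, `sin`, `exp` —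
`MultiPrecisionInterval.lean` —, and decidable inequalities between rationals):

* `MertensConjectureDisproofCertificate.lean` — a zero bracketing (`Literature.NumberTheory.LFunctions.ZeroBracketing`) and
  `N(T) ≤ n` give the rh.S22 statements from bounds `Σ_j 2 Re F_y(γ_j)` over the brackets
  (`ZeroBracketing.not_mertens_conjecture_of_bounds`, …), on top of the zero clause and the
  reduction of `h_K` of `MertensZeroCertificate.lean`;
* `HardyZSignCertificate.lean` — the sign change of `Z` across a bracket `[t₀ − r, t₀ + r]` from
  `ζ(½+it₀)`, `ζ'(½+it₀)` and the Stirling main term of `θ` (`hardyZ_mul_hardyZ_neg_of_center`,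
  `abs_sub_riemannSiegelTheta_lt_of_stirling`) — one accurate value of `ζ` per bracket;
* `MertensZeroCertificate.lean` — `N(T) = n` from a certified piece list for `ζ` along
  `[½, 2] × {T}` and the Stirling main term (`zetaZeroCount_eq_of_hpieces_stirling`).

It also reduces the final bounds to inequalities between *elementary* functions of the `γ_j` and
complex parameters `D_j` within an explicit distance of rough *point* values of `ζ'(½+it₀ⱼ)`
(`sum_inghamTerm_gt_of_elementary`, `sum_inghamTerm_lt_of_elementary`: `ζ'` is
`2(t₀+15)³`-Lipschitz near the line), so that no evaluation of `ζ'` on boxes is required.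
Data for the Odlyzko–te Riele instance (`n = 2000` ordinates to `2⁻²⁴⁰`, a piece list at height
`2516`, the two `y` of Table 3, per-block bounds) are in `MertensCertificateData.lean`, consumed by
the checkers of that author's `MertensCertificate.lean`; the statements below are the
checker-independent form of the same obligations.

## Main results (namespace `Literature.RH`, all proved)

* `ZeroBracketing.of_center` — a `ZeroBracketing n T (t₀ − r) (t₀ + r)` from centre data.
* `not_mertens_conjecture_of_certificate`, `odlyzko_te_riele_limsup_of_certificate`,
  `odlyzko_te_riele_liminf_of_certificate`, `OdlyzkoTeRiele1985_table3_of_certificate`.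
* `norm_deriv_riemannZeta_sub_le_near_line`, `sum_inghamTerm_gt_of_elementary`,
  `sum_inghamTerm_lt_of_elementary` (centre-data route); `sum_inghamTerm_gt_of_slope`,
  `sum_inghamTerm_lt_of_slope`, `not_mertens_conjecture_of_twisted_certificate`,
  `odlyzko_te_riele_limsup_of_twisted_certificate`, `odlyzko_te_riele_liminf_of_twisted_certificate`
  (twisted-sign-test route of `MertensZeroCertificate.lean`: two accurate `ζ` values per bracket,
  which also enclose `ζ'` via `norm_deriv_riemannZeta_sub_slope_le`).

## References

* [OdlyzkoTeRiele1985] §4.2–4.3, pp. 151–155 (the computation being certified).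
* [EdwardsZeta1974] §6.6 (Backlund's `N(T)`), §8.3 (zeros from sign changes of `Z`).
-/

noncomputable section

open Complex Filter Set
open scoped Real Topology

namespace Literature.NumberTheory.LFunctions

open Literature.Analysis.Complex

namespace ZeroBracketing

variable {n : ℕ} {T r : ℝ} {t₀ φ₁ φ₂ : Fin n → ℝ}

/-- **A zero bracketing from centre data.** Centres `t₀ j ≥ 8`, a common half-width
`0 < r ≤ ½`, separation `t₀ j + r < t₀ k − r` (`j < k`), `t₀ j + r < T`, rotation angles `φ₁ j`,
`φ₂ j` within `π/2` of `θ(t₀ j ∓ r)` as certified from the Stirling main term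
`M(t) = (t/2) log(t/2π) − t/2 − π/8` (`|φ − M(t)| + 2K(¼)/t < π/2`), and for each `j` the
centre-data sign condition of `hardyZ_mul_hardyZ_neg_of_center` (`W = ζ(½+it₀)`, `D = ζ'(½+it₀)`,
`E = 2(t₀+15)³r²`: `Re (e^{iφ₁}(W − irD)) < −E ∧ E < Re (e^{iφ₂}(W + irD))` or the mirror image)
give a zero bracketing with brackets `[t₀ j − r, t₀ j + r]`. [cite: EdwardsZeta1974, §8.3] -/
theorem of_center (hr : 0 < r) (hr2 : r ≤ 1 / 2) (h8 : ∀ j, 8 ≤ t₀ j)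
    (hsep : ∀ j k, j < k → t₀ j + r < t₀ k - r) (hT : ∀ j, t₀ j + r < T)
    (hφ₁ : ∀ j, |φ₁ j - (((t₀ j - r) / 2) * Real.log ((t₀ j - r) / (2 * π)) - (t₀ j - r) / 2 - π / 8)|
      + 2 * stirlingVertRate (1 / 4) / (t₀ j - r) < π / 2)
    (hφ₂ : ∀ j, |φ₂ j - (((t₀ j + r) / 2) * Real.log ((t₀ j + r) / (2 * π)) - (t₀ j + r) / 2 - π / 8)|
      + 2 * stirlingVertRate (1 / 4) / (t₀ j + r) < π / 2)
    (hsign : ∀ j,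
      ((cexp (φ₁ j * I) * (riemannZeta (1 / 2 + t₀ j * I) -
            r * I * deriv riemannZeta (1 / 2 + t₀ j * I))).re < -(2 * (t₀ j + 15) ^ 3 * r ^ 2) ∧
        2 * (t₀ j + 15) ^ 3 * r ^ 2 < (cexp (φ₂ j * I) * (riemannZeta (1 / 2 + t₀ j * I) +
            r * I * deriv riemannZeta (1 / 2 + t₀ j * I))).re) ∨
      (2 * (t₀ j + 15) ^ 3 * r ^ 2 < (cexp (φ₁ j * I) * (riemannZeta (1 / 2 + t₀ j * I) -
            r * I * deriv riemannZeta (1 / 2 + t₀ j * I))).re ∧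
        (cexp (φ₂ j * I) * (riemannZeta (1 / 2 + t₀ j * I) +
            r * I * deriv riemannZeta (1 / 2 + t₀ j * I))).re < -(2 * (t₀ j + 15) ^ 3 * r ^ 2))) :
    ZeroBracketing n T (fun j ↦ t₀ j - r) (fun j ↦ t₀ j + r) := by
  refine of_hardyZ_sign (fun j ↦ by linarith) (fun j k hjk ↦ hsep j k hjk)
    (fun j ↦ by linarith [h8 j]) hT fun j ↦ ?_
  have h1 : |φ₁ j - riemannSiegelTheta (t₀ j - r)| < π / 2 :=
    abs_sub_riemannSiegelTheta_lt_of_stirling (by linarith [h8 j]) (hφ₁ j)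
  have h2 : |φ₂ j - riemannSiegelTheta (t₀ j + r)| < π / 2 :=
    abs_sub_riemannSiegelTheta_lt_of_stirling (by linarith [h8 j]) (hφ₂ j)
  exact hardyZ_mul_hardyZ_neg_of_center (h8 j) hr hr2 h1 h2 (hsign j)

end ZeroBracketing

/-! ## The bounds in elementary form: rough point values of `ζ'` suffice -/

/-- `ζ'` is `2(t₀+15)³`-Lipschitz within distance `½` of `½ + it₀` (`t₀ ≥ 8`; from
`‖ζ''‖ ≤ 2(t₀+15)³` there, `norm_deriv_deriv_riemannZeta_le_near_line`). [folklore] -/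
theorem norm_deriv_riemannZeta_sub_le_near_line {t₀ : ℝ} (ht : 8 ≤ t₀) {z : ℂ}
    (hz : ‖z - ((1 / 2 : ℂ) + t₀ * I)‖ ≤ 1 / 2) :
    ‖deriv riemannZeta z - deriv riemannZeta ((1 / 2 : ℂ) + t₀ * I)‖ ≤
      2 * (t₀ + 15) ^ 3 * ‖z - ((1 / 2 : ℂ) + t₀ * I)‖ := by
  set c : ℂ := (1 / 2 : ℂ) + t₀ * I with hc
  set D := Metric.closedBall c (1 / 2)
  have hconv : Convex ℝ D := convex_closedBall c _
  have hzD : z ∈ D := by rw [Metric.mem_closedBall, dist_eq_norm]; exact hz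
  have hcD : c ∈ D := Metric.mem_closedBall_self (by norm_num)
  have hne1 : ∀ w ∈ D, w ≠ 1 := by
    intro w hw h1
    rw [h1, Metric.mem_closedBall, dist_eq_norm] at hw
    have := abs_im_le_norm (1 - c)
    simp [hc] at this
    rw [abs_le] at this
    linarith [this.2]
  have hM2 : ∀ w ∈ D, ‖deriv (deriv riemannZeta) w‖ ≤ 2 * (t₀ + 15) ^ 3 := fun w hw ↦
    norm_deriv_deriv_riemannZeta_le_near_line ht hw
  have hdiff2 : ∀ w ∈ D, DifferentiableAt ℂ (deriv riemannZeta) w := fun w hw ↦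
    (analyticOn_riemannZeta w (hne1 w hw)).deriv.differentiableAt
  exact hconv.norm_image_sub_le_of_norm_deriv_le hdiff2 hM2 hcD hzD

section Elementary

variable {n : ℕ} {T r : ℝ} {t₀ : Fin n → ℝ}

/-- On a bracket of half-width `r ≤ ½` about `t₀ ≥ 8`, `ζ'(½+iγ)` is within `δ + 2(t₀+15)³r` of
any `Dc` with `‖ζ'(½+it₀) − Dc‖ ≤ δ`. [folklore] -/
theorem norm_deriv_riemannZeta_sub_data_le {t γ Rr δ : ℝ} (h8 : 8 ≤ t) (hr2 : Rr ≤ 1 / 2)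
    (hγ : t - Rr ≤ γ ∧ γ ≤ t + Rr) {Dc : ℂ} (hD : ‖deriv riemannZeta (1 / 2 + t * I) - Dc‖ ≤ δ) :
    ‖deriv riemannZeta (1 / 2 + γ * I) - Dc‖ ≤ δ + 2 * (t + 15) ^ 3 * Rr := by
  have hz : ‖((1 / 2 : ℂ) + γ * I) - ((1 / 2 : ℂ) + t * I)‖ ≤ Rr := by
    rw [show ((1 / 2 : ℂ) + γ * I) - ((1 / 2 : ℂ) + t * I) = ((γ - t : ℝ) : ℂ) * I by
      push_cast; ring, norm_mul, Complex.norm_real, Complex.norm_I, mul_one, Real.norm_eq_abs,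
      abs_le]
    constructor <;> linarith [hγ.1, hγ.2]
  have hRr : 0 ≤ Rr := (norm_nonneg _).trans hz
  have hL := norm_deriv_riemannZeta_sub_le_near_line h8 (hz.trans hr2)
  calc ‖deriv riemannZeta (1 / 2 + γ * I) - Dc‖
      = ‖(deriv riemannZeta (1 / 2 + γ * I) - deriv riemannZeta (1 / 2 + t * I)) +
          (deriv riemannZeta (1 / 2 + t * I) - Dc)‖ := by rw [sub_add_sub_cancel]
    _ ≤ ‖deriv riemannZeta (1 / 2 + γ * I) - deriv riemannZeta (1 / 2 + t * I)‖ +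
          ‖deriv riemannZeta (1 / 2 + t * I) - Dc‖ := norm_add_le _ _
    _ ≤ 2 * (t + 15) ^ 3 * Rr + δ := by
        refine add_le_add (hL.trans ?_) hD
        exact mul_le_mul_of_nonneg_left hz (by positivity)
    _ = δ + 2 * (t + 15) ^ 3 * Rr := by ring

/-- **Reduction of the lower bound to elementary functions.** Suppose `‖ζ'(½+it₀ⱼ) − Dc j‖ ≤ δ j`
(rough point enclosures, `t₀ j ≥ 8`, `r ≤ ½`) and that the inequality
`c < Σ_j 2 Re (k(γ_j) e^{iγ_j y}/((½+iγ_j) D_j))` holds for all `γ_j ∈ [t₀ j − r, t₀ j + r]` and all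
`D_j` with `‖D_j − Dc j‖ ≤ δ j + 2(t₀ j+15)³ r`. Then `c < Σ_j 2 Re F_y(γ_j)` for all `γ_j` in the
brackets (the hypothesis of `ZeroBracketing.not_mertens_conjecture_of_bounds` and its siblings,
for the bracketing of `ZeroBracketing.of_center`). [folklore] -/
theorem sum_inghamTerm_gt_of_elementary (h8 : ∀ j, 8 ≤ t₀ j) (hr2 : r ≤ 1 / 2)
    {Dc : Fin n → ℂ} {δ : Fin n → ℝ}
    (hD : ∀ j, ‖deriv riemannZeta (1 / 2 + t₀ j * I) - Dc j‖ ≤ δ j) {k : ℝ → ℂ} {y c : ℝ}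
    (hel : ∀ γ : Fin n → ℝ, ∀ D : Fin n → ℂ, (∀ j, t₀ j - r ≤ γ j ∧ γ j ≤ t₀ j + r) →
      (∀ j, ‖D j - Dc j‖ ≤ δ j + 2 * (t₀ j + 15) ^ 3 * r) →
      c < ∑ j : Fin n, 2 * (k (γ j) * cexp (I * (γ j * y)) / ((1 / 2 + γ j * I) * D j)).re) :
    ∀ γ : Fin n → ℝ, (∀ j, t₀ j - r ≤ γ j ∧ γ j ≤ t₀ j + r) →
      c < ∑ j : Fin n, 2 * (inghamTerm k y (γ j)).re := fun γ hγ ↦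
  hel γ (fun j ↦ deriv riemannZeta (1 / 2 + γ j * I)) hγ
    (fun j ↦ norm_deriv_riemannZeta_sub_data_le (h8 j) hr2 (hγ j) (hD j))

/-- Dually for upper bounds `Σ_j 2 Re F_y(γ_j) < c`. [folklore] -/
theorem sum_inghamTerm_lt_of_elementary (h8 : ∀ j, 8 ≤ t₀ j) (hr2 : r ≤ 1 / 2)
    {Dc : Fin n → ℂ} {δ : Fin n → ℝ}
    (hD : ∀ j, ‖deriv riemannZeta (1 / 2 + t₀ j * I) - Dc j‖ ≤ δ j) {k : ℝ → ℂ} {y c : ℝ}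
    (hel : ∀ γ : Fin n → ℝ, ∀ D : Fin n → ℂ, (∀ j, t₀ j - r ≤ γ j ∧ γ j ≤ t₀ j + r) →
      (∀ j, ‖D j - Dc j‖ ≤ δ j + 2 * (t₀ j + 15) ^ 3 * r) →
      ∑ j : Fin n, 2 * (k (γ j) * cexp (I * (γ j * y)) / ((1 / 2 + γ j * I) * D j)).re < c) :
    ∀ γ : Fin n → ℝ, (∀ j, t₀ j - r ≤ γ j ∧ γ j ≤ t₀ j + r) →
      ∑ j : Fin n, 2 * (inghamTerm k y (γ j)).re < c := fun γ hγ ↦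
  hel γ (fun j ↦ deriv riemannZeta (1 / 2 + γ j * I)) hγ
    (fun j ↦ norm_deriv_riemannZeta_sub_data_le (h8 j) hr2 (hγ j) (hD j))

end Elementary

section Slope

variable {n : ℕ} {T : ℝ} {a b : Fin n → ℝ}

/-- **Reduction of the lower bound to elementary functions, slope form** (for brackets certified
by the twisted sign test, whose two accurate values of `ζ` also enclose `ζ'` on the bracket:
`norm_deriv_riemannZeta_sub_slope_le`, `MertensZeroCertificate.lean`). If `2 ≤ a_j < b_j` and the
inequality `c < Σ_j 2 Re (k(γ_j) e^{iγ_j y}/((½+iγ_j) D_j))` holds for all `γ_j ∈ [a_j, b_j]` and all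
`D_j` with `‖D_j − (ζ(½+ib_j) − ζ(½+ia_j))/((b_j − a_j) i)‖ ≤ (b_j − a_j) · 4(b_j + 4)³`, then
`c < Σ_j 2 Re F_y(γ_j)` for all `γ_j` in the brackets. [folklore] -/
theorem sum_inghamTerm_gt_of_slope (h2 : ∀ j, 2 ≤ a j) (hab : ∀ j, a j < b j) {k : ℝ → ℂ}
    {y c : ℝ}
    (hel : ∀ γ : Fin n → ℝ, ∀ D : Fin n → ℂ, (∀ j, a j ≤ γ j ∧ γ j ≤ b j) →
      (∀ j, ‖D j - (riemannZeta (1 / 2 + b j * I) - riemannZeta (1 / 2 + a j * I)) /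
          ((b j - a j : ℝ) * I)‖ ≤ (b j - a j) * (4 * (b j + 4) ^ 3)) →
      c < ∑ j : Fin n, 2 * (k (γ j) * cexp (I * (γ j * y)) / ((1 / 2 + γ j * I) * D j)).re) :
    ∀ γ : Fin n → ℝ, (∀ j, a j ≤ γ j ∧ γ j ≤ b j) →
      c < ∑ j : Fin n, 2 * (inghamTerm k y (γ j)).re := fun γ hγ ↦
  hel γ (fun j ↦ deriv riemannZeta (1 / 2 + γ j * I)) hγ
    (fun j ↦ norm_deriv_riemannZeta_sub_slope_le (h2 j) (hab j) ⟨(hγ j).1, (hγ j).2⟩)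

/-- Dually for upper bounds, slope form. [folklore] -/
theorem sum_inghamTerm_lt_of_slope (h2 : ∀ j, 2 ≤ a j) (hab : ∀ j, a j < b j) {k : ℝ → ℂ}
    {y c : ℝ}
    (hel : ∀ γ : Fin n → ℝ, ∀ D : Fin n → ℂ, (∀ j, a j ≤ γ j ∧ γ j ≤ b j) →
      (∀ j, ‖D j - (riemannZeta (1 / 2 + b j * I) - riemannZeta (1 / 2 + a j * I)) /
          ((b j - a j : ℝ) * I)‖ ≤ (b j - a j) * (4 * (b j + 4) ^ 3)) →
      ∑ j : Fin n, 2 * (k (γ j) * cexp (I * (γ j * y)) / ((1 / 2 + γ j * I) * D j)).re < c) :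
    ∀ γ : Fin n → ℝ, (∀ j, a j ≤ γ j ∧ γ j ≤ b j) →
      ∑ j : Fin n, 2 * (inghamTerm k y (γ j)).re < c := fun γ hγ ↦
  hel γ (fun j ↦ deriv riemannZeta (1 / 2 + γ j * I)) hγ
    (fun j ↦ norm_deriv_riemannZeta_sub_slope_le (h2 j) (hab j) ⟨(hγ j).1, (hγ j).2⟩)

/-- **The Mertens conjecture is false — from a twisted-sign-test certificate** (the route of
`MertensZeroCertificate.lean`: two accurate values of `ζ` per bracket, no `θ`): brackets
`2 ≤ a_j < b_j ≤ 2²⁰`, `b_j − a_j ≤ 1/8`, separated, `b_j < T`; `Re (ζ(½+ia_j) conj ζ(½+ib_j)) < 0`;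
the count certificate at `T`; and the elementary bound in slope form at some `y`.
[cite: OdlyzkoTeRiele1985, §4 pp. 149–155 with Theorem p. 144 and (1.3) p. 139] -/
theorem not_mertens_conjecture_of_twisted_certificate {x₁ : ℝ} {d₁ : Fin 4}
    {L : List (ℝ × Fin 4)}
    (h2 : ∀ j, 2 ≤ a j) (hab : ∀ j, a j < b j) (htop : ∀ j, b j ≤ 2 ^ 20)
    (hgap : ∀ j, b j - a j ≤ 1 / 8) (hsep : ∀ j k, j < k → b j < a k) (hltT : ∀ j, b j < T)
    (hneg : ∀ j, (riemannZeta (1 / 2 + a j * I) *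
      (starRingEnd ℂ) (riemannZeta (1 / 2 + b j * I))).re < 0)
    (hT2 : 2 ≤ T) (hP : HPieces riemannZeta T (1 / 2) ((x₁, d₁) :: L))
    (hlast : piecesLast x₁ L = 2) (hdir : piecesLastDir d₁ L = 0)
    (hcount : |(T / 2 * Real.log (T / (2 * π)) - T / 2 - π / 8) / π + 1 -
        (piecesTurns d₁ L : ℝ) / 2 - n| + 2 * stirlingVertRate (1 / 4) / (π * T) ≤ 1 / 2)
    {y : ℝ}
    (hel : ∀ γ : Fin n → ℝ, ∀ D : Fin n → ℂ, (∀ j, a j ≤ γ j ∧ γ j ≤ b j) →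
      (∀ j, ‖D j - (riemannZeta (1 / 2 + b j * I) - riemannZeta (1 / 2 + a j * I)) /
          ((b j - a j : ℝ) * I)‖ ≤ (b j - a j) * (4 * (b j + 4) ^ 3)) →
      (1 : ℝ) < ∑ j : Fin n, 2 * ((jurkatPeyerimhoffKernel (γ j / T) : ℂ) * cexp (I * (γ j * y)) /
        ((1 / 2 + γ j * I) * D j)).re) :
    not_mertens_conjecture := by
  have hB : ZeroBracketing n T a b :=
    ZeroBracketing.of_re_mul_conj_neg (fun j ↦ (hab j).le) hsep (fun j ↦ by linarith [h2 j]) htop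
      hgap hltT hneg
  have hN : zetaZeroCount T = n := MertensZeroCertificate.zetaZeroCount_eq_of_hpieces_stirling hT2 hP hlast hdir hcount
  exact hB.not_mertens_conjecture_of_bounds (by linarith) hN.le
    (sum_inghamTerm_gt_of_slope (k := fun t : ℝ => (jurkatPeyerimhoffKernel (t / T) : ℂ)) h2 hab hel)

/-- `limsup` side of rh.S22 from a twisted-sign-test certificate (bound `> 1.06`).
[cite: OdlyzkoTeRiele1985, §1 p. 139 and §4.3 Table 3 p. 155] -/
theorem odlyzko_te_riele_limsup_of_twisted_certificate {x₁ : ℝ} {d₁ : Fin 4}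
    {L : List (ℝ × Fin 4)}
    (h2 : ∀ j, 2 ≤ a j) (hab : ∀ j, a j < b j) (htop : ∀ j, b j ≤ 2 ^ 20)
    (hgap : ∀ j, b j - a j ≤ 1 / 8) (hsep : ∀ j k, j < k → b j < a k) (hltT : ∀ j, b j < T)
    (hneg : ∀ j, (riemannZeta (1 / 2 + a j * I) *
      (starRingEnd ℂ) (riemannZeta (1 / 2 + b j * I))).re < 0)
    (hT2 : 2 ≤ T) (hP : HPieces riemannZeta T (1 / 2) ((x₁, d₁) :: L))
    (hlast : piecesLast x₁ L = 2) (hdir : piecesLastDir d₁ L = 0)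
    (hcount : |(T / 2 * Real.log (T / (2 * π)) - T / 2 - π / 8) / π + 1 -
        (piecesTurns d₁ L : ℝ) / 2 - n| + 2 * stirlingVertRate (1 / 4) / (π * T) ≤ 1 / 2)
    {y : ℝ}
    (hel : ∀ γ : Fin n → ℝ, ∀ D : Fin n → ℂ, (∀ j, a j ≤ γ j ∧ γ j ≤ b j) →
      (∀ j, ‖D j - (riemannZeta (1 / 2 + b j * I) - riemannZeta (1 / 2 + a j * I)) /
          ((b j - a j : ℝ) * I)‖ ≤ (b j - a j) * (4 * (b j + 4) ^ 3)) →
      (1.06 : ℝ) < ∑ j : Fin n, 2 * ((jurkatPeyerimhoffKernel (γ j / T) : ℂ) *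
        cexp (I * (γ j * y)) / ((1 / 2 + γ j * I) * D j)).re) :
    odlyzko_te_riele_limsup := by
  have hB : ZeroBracketing n T a b :=
    ZeroBracketing.of_re_mul_conj_neg (fun j ↦ (hab j).le) hsep (fun j ↦ by linarith [h2 j]) htop
      hgap hltT hneg
  have hN : zetaZeroCount T = n := MertensZeroCertificate.zetaZeroCount_eq_of_hpieces_stirling hT2 hP hlast hdir hcount
  exact hB.limsup_of_bounds (by linarith) hN.le
    (sum_inghamTerm_gt_of_slope (k := fun t : ℝ => (jurkatPeyerimhoffKernel (t / T) : ℂ)) h2 hab hel)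

/-- `liminf` side of rh.S22 from a twisted-sign-test certificate (bound `< -1.009`).
[cite: OdlyzkoTeRiele1985, §1 p. 139 and §4.3 Table 3 p. 155] -/
theorem odlyzko_te_riele_liminf_of_twisted_certificate {x₁ : ℝ} {d₁ : Fin 4}
    {L : List (ℝ × Fin 4)}
    (h2 : ∀ j, 2 ≤ a j) (hab : ∀ j, a j < b j) (htop : ∀ j, b j ≤ 2 ^ 20)
    (hgap : ∀ j, b j - a j ≤ 1 / 8) (hsep : ∀ j k, j < k → b j < a k) (hltT : ∀ j, b j < T)
    (hneg : ∀ j, (riemannZeta (1 / 2 + a j * I) *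
      (starRingEnd ℂ) (riemannZeta (1 / 2 + b j * I))).re < 0)
    (hT2 : 2 ≤ T) (hP : HPieces riemannZeta T (1 / 2) ((x₁, d₁) :: L))
    (hlast : piecesLast x₁ L = 2) (hdir : piecesLastDir d₁ L = 0)
    (hcount : |(T / 2 * Real.log (T / (2 * π)) - T / 2 - π / 8) / π + 1 -
        (piecesTurns d₁ L : ℝ) / 2 - n| + 2 * stirlingVertRate (1 / 4) / (π * T) ≤ 1 / 2)
    {y : ℝ}
    (hel : ∀ γ : Fin n → ℝ, ∀ D : Fin n → ℂ, (∀ j, a j ≤ γ j ∧ γ j ≤ b j) →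
      (∀ j, ‖D j - (riemannZeta (1 / 2 + b j * I) - riemannZeta (1 / 2 + a j * I)) /
          ((b j - a j : ℝ) * I)‖ ≤ (b j - a j) * (4 * (b j + 4) ^ 3)) →
      ∑ j : Fin n, 2 * ((jurkatPeyerimhoffKernel (γ j / T) : ℂ) *
        cexp (I * (γ j * y)) / ((1 / 2 + γ j * I) * D j)).re < -1.009) :
    odlyzko_te_riele_liminf := by
  have hB : ZeroBracketing n T a b :=
    ZeroBracketing.of_re_mul_conj_neg (fun j ↦ (hab j).le) hsep (fun j ↦ by linarith [h2 j]) htop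
      hgap hltT hneg
  have hN : zetaZeroCount T = n := MertensZeroCertificate.zetaZeroCount_eq_of_hpieces_stirling hT2 hP hlast hdir hcount
  exact hB.liminf_of_bounds (by linarith) hN.le
    (sum_inghamTerm_lt_of_slope (k := fun t : ℝ => (jurkatPeyerimhoffKernel (t / T) : ℂ)) h2 hab hel)

end Slope

/-! ## The assembled statements (centre-data route) -/

section Assembly

variable {n : ℕ} {T r : ℝ} {t₀ φ₁ φ₂ : Fin n → ℝ} {x₁ : ℝ} {d₁ : Fin 4} {L : List (ℝ × Fin 4)}

/-- **The Mertens conjecture is false — from a finite certificate.** Hypotheses, all arithmetic: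
(i) bracket data: centres `t₀ j ≥ 8`, a half-width `0 < r ≤ ½`, separation, `t₀ j + r < T`;
(ii) for each bracket, rotation angles controlled by the Stirling main term and the centre-data
sign condition (`ζ(½+it₀)` accurately, `ζ'(½+it₀)` roughly); (iii) a certified piece list for `ζ`
along `[½, 2] × {T}` (`T ≥ 2`) ending with label `0` and the count inequality pinning `N(T) = n`
(`zetaZeroCount_eq_of_hpieces_stirling`); (iv) at some `y`, a validated bound
`1 < Σ_j 2 Re F_y(γ_j)` over all `γ_j` in the brackets, `F_y = inghamTerm (k(·/T)) y` with the
Jurkat–Peyerimhoff weight (reducible further by `sum_inghamTerm_gt_of_elementary`). Conclusion: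
`not_mertens_conjecture` (rh.S22). [cite: OdlyzkoTeRiele1985, §4 pp. 149–155 with Theorem p. 144 and (1.3) p. 139] -/
theorem not_mertens_conjecture_of_certificate
    (hr : 0 < r) (hr2 : r ≤ 1 / 2) (h8 : ∀ j, 8 ≤ t₀ j)
    (hsep : ∀ j k, j < k → t₀ j + r < t₀ k - r) (hT : ∀ j, t₀ j + r < T)
    (hφ₁ : ∀ j, |φ₁ j - (((t₀ j - r) / 2) * Real.log ((t₀ j - r) / (2 * π)) - (t₀ j - r) / 2 - π / 8)|
      + 2 * stirlingVertRate (1 / 4) / (t₀ j - r) < π / 2)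
    (hφ₂ : ∀ j, |φ₂ j - (((t₀ j + r) / 2) * Real.log ((t₀ j + r) / (2 * π)) - (t₀ j + r) / 2 - π / 8)|
      + 2 * stirlingVertRate (1 / 4) / (t₀ j + r) < π / 2)
    (hsign : ∀ j,
      ((cexp (φ₁ j * I) * (riemannZeta (1 / 2 + t₀ j * I) -
            r * I * deriv riemannZeta (1 / 2 + t₀ j * I))).re < -(2 * (t₀ j + 15) ^ 3 * r ^ 2) ∧
        2 * (t₀ j + 15) ^ 3 * r ^ 2 < (cexp (φ₂ j * I) * (riemannZeta (1 / 2 + t₀ j * I) +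
            r * I * deriv riemannZeta (1 / 2 + t₀ j * I))).re) ∨
      (2 * (t₀ j + 15) ^ 3 * r ^ 2 < (cexp (φ₁ j * I) * (riemannZeta (1 / 2 + t₀ j * I) -
            r * I * deriv riemannZeta (1 / 2 + t₀ j * I))).re ∧
        (cexp (φ₂ j * I) * (riemannZeta (1 / 2 + t₀ j * I) +
            r * I * deriv riemannZeta (1 / 2 + t₀ j * I))).re < -(2 * (t₀ j + 15) ^ 3 * r ^ 2)))
    (hT2 : 2 ≤ T) (hP : HPieces riemannZeta T (1 / 2) ((x₁, d₁) :: L))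
    (hlast : piecesLast x₁ L = 2) (hdir : piecesLastDir d₁ L = 0)
    (hcount : |(T / 2 * Real.log (T / (2 * π)) - T / 2 - π / 8) / π + 1 -
        (piecesTurns d₁ L : ℝ) / 2 - n| + 2 * stirlingVertRate (1 / 4) / (π * T) ≤ 1 / 2)
    {y : ℝ}
    (hval : ∀ γ : Fin n → ℝ, (∀ j, t₀ j - r ≤ γ j ∧ γ j ≤ t₀ j + r) → (1 : ℝ) <
      ∑ j : Fin n, 2 * (inghamTerm (fun t : ℝ => (jurkatPeyerimhoffKernel (t / T) : ℂ)) y (γ j)).re) :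
    not_mertens_conjecture := by
  have hB := ZeroBracketing.of_center hr hr2 h8 hsep hT hφ₁ hφ₂ hsign
  have hN : zetaZeroCount T = n := MertensZeroCertificate.zetaZeroCount_eq_of_hpieces_stirling hT2 hP hlast hdir hcount
  exact hB.not_mertens_conjecture_of_bounds (by linarith) hN.le hval

/-- **`limsup M(x)x^{-1/2} > 1.06` from a finite certificate** (bound `> 1.06` in (iv)).
[cite: OdlyzkoTeRiele1985, §1 p. 139 and §4.3 Table 3 p. 155] -/
theorem odlyzko_te_riele_limsup_of_certificate
    (hr : 0 < r) (hr2 : r ≤ 1 / 2) (h8 : ∀ j, 8 ≤ t₀ j)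
    (hsep : ∀ j k, j < k → t₀ j + r < t₀ k - r) (hT : ∀ j, t₀ j + r < T)
    (hφ₁ : ∀ j, |φ₁ j - (((t₀ j - r) / 2) * Real.log ((t₀ j - r) / (2 * π)) - (t₀ j - r) / 2 - π / 8)|
      + 2 * stirlingVertRate (1 / 4) / (t₀ j - r) < π / 2)
    (hφ₂ : ∀ j, |φ₂ j - (((t₀ j + r) / 2) * Real.log ((t₀ j + r) / (2 * π)) - (t₀ j + r) / 2 - π / 8)|
      + 2 * stirlingVertRate (1 / 4) / (t₀ j + r) < π / 2)
    (hsign : ∀ j,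
      ((cexp (φ₁ j * I) * (riemannZeta (1 / 2 + t₀ j * I) -
            r * I * deriv riemannZeta (1 / 2 + t₀ j * I))).re < -(2 * (t₀ j + 15) ^ 3 * r ^ 2) ∧
        2 * (t₀ j + 15) ^ 3 * r ^ 2 < (cexp (φ₂ j * I) * (riemannZeta (1 / 2 + t₀ j * I) +
            r * I * deriv riemannZeta (1 / 2 + t₀ j * I))).re) ∨
      (2 * (t₀ j + 15) ^ 3 * r ^ 2 < (cexp (φ₁ j * I) * (riemannZeta (1 / 2 + t₀ j * I) -
            r * I * deriv riemannZeta (1 / 2 + t₀ j * I))).re ∧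
        (cexp (φ₂ j * I) * (riemannZeta (1 / 2 + t₀ j * I) +
            r * I * deriv riemannZeta (1 / 2 + t₀ j * I))).re < -(2 * (t₀ j + 15) ^ 3 * r ^ 2)))
    (hT2 : 2 ≤ T) (hP : HPieces riemannZeta T (1 / 2) ((x₁, d₁) :: L))
    (hlast : piecesLast x₁ L = 2) (hdir : piecesLastDir d₁ L = 0)
    (hcount : |(T / 2 * Real.log (T / (2 * π)) - T / 2 - π / 8) / π + 1 -
        (piecesTurns d₁ L : ℝ) / 2 - n| + 2 * stirlingVertRate (1 / 4) / (π * T) ≤ 1 / 2)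
    {y : ℝ}
    (hval : ∀ γ : Fin n → ℝ, (∀ j, t₀ j - r ≤ γ j ∧ γ j ≤ t₀ j + r) → (1.06 : ℝ) <
      ∑ j : Fin n, 2 * (inghamTerm (fun t : ℝ => (jurkatPeyerimhoffKernel (t / T) : ℂ)) y (γ j)).re) :
    odlyzko_te_riele_limsup := by
  have hB := ZeroBracketing.of_center hr hr2 h8 hsep hT hφ₁ hφ₂ hsign
  have hN : zetaZeroCount T = n := MertensZeroCertificate.zetaZeroCount_eq_of_hpieces_stirling hT2 hP hlast hdir hcount
  exact hB.limsup_of_bounds (by linarith) hN.le hval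

/-- **`liminf M(x)x^{-1/2} < -1.009` from a finite certificate** (bound `< -1.009` in (iv)).
[cite: OdlyzkoTeRiele1985, §1 p. 139 and §4.3 Table 3 p. 155] -/
theorem odlyzko_te_riele_liminf_of_certificate
    (hr : 0 < r) (hr2 : r ≤ 1 / 2) (h8 : ∀ j, 8 ≤ t₀ j)
    (hsep : ∀ j k, j < k → t₀ j + r < t₀ k - r) (hT : ∀ j, t₀ j + r < T)
    (hφ₁ : ∀ j, |φ₁ j - (((t₀ j - r) / 2) * Real.log ((t₀ j - r) / (2 * π)) - (t₀ j - r) / 2 - π / 8)|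
      + 2 * stirlingVertRate (1 / 4) / (t₀ j - r) < π / 2)
    (hφ₂ : ∀ j, |φ₂ j - (((t₀ j + r) / 2) * Real.log ((t₀ j + r) / (2 * π)) - (t₀ j + r) / 2 - π / 8)|
      + 2 * stirlingVertRate (1 / 4) / (t₀ j + r) < π / 2)
    (hsign : ∀ j,
      ((cexp (φ₁ j * I) * (riemannZeta (1 / 2 + t₀ j * I) -
            r * I * deriv riemannZeta (1 / 2 + t₀ j * I))).re < -(2 * (t₀ j + 15) ^ 3 * r ^ 2) ∧
        2 * (t₀ j + 15) ^ 3 * r ^ 2 < (cexp (φ₂ j * I) * (riemannZeta (1 / 2 + t₀ j * I) +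
            r * I * deriv riemannZeta (1 / 2 + t₀ j * I))).re) ∨
      (2 * (t₀ j + 15) ^ 3 * r ^ 2 < (cexp (φ₁ j * I) * (riemannZeta (1 / 2 + t₀ j * I) -
            r * I * deriv riemannZeta (1 / 2 + t₀ j * I))).re ∧
        (cexp (φ₂ j * I) * (riemannZeta (1 / 2 + t₀ j * I) +
            r * I * deriv riemannZeta (1 / 2 + t₀ j * I))).re < -(2 * (t₀ j + 15) ^ 3 * r ^ 2)))
    (hT2 : 2 ≤ T) (hP : HPieces riemannZeta T (1 / 2) ((x₁, d₁) :: L))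
    (hlast : piecesLast x₁ L = 2) (hdir : piecesLastDir d₁ L = 0)
    (hcount : |(T / 2 * Real.log (T / (2 * π)) - T / 2 - π / 8) / π + 1 -
        (piecesTurns d₁ L : ℝ) / 2 - n| + 2 * stirlingVertRate (1 / 4) / (π * T) ≤ 1 / 2)
    {y : ℝ}
    (hval : ∀ γ : Fin n → ℝ, (∀ j, t₀ j - r ≤ γ j ∧ γ j ≤ t₀ j + r) →
      ∑ j : Fin n, 2 * (inghamTerm (fun t : ℝ => (jurkatPeyerimhoffKernel (t / T) : ℂ)) y (γ j)).re
        < -1.009) :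
    odlyzko_te_riele_liminf := by
  have hB := ZeroBracketing.of_center hr hr2 h8 hsep hT hφ₁ hφ₂ hsign
  have hN : zetaZeroCount T = n := MertensZeroCertificate.zetaZeroCount_eq_of_hpieces_stirling hT2 hP hlast hdir hcount
  exact hB.liminf_of_bounds (by linarith) hN.le hval

/-- **Table 3 (both values) from a finite certificate** at a height `T ∈ (2515, 2516)`: the named
fact `OdlyzkoTeRiele1985_table3` as printed. [cite: OdlyzkoTeRiele1985, §4.3 Table 3 p. 155] -/
theorem OdlyzkoTeRiele1985_table3_of_certificate
    (hr : 0 < r) (hr2 : r ≤ 1 / 2) (h8 : ∀ j, 8 ≤ t₀ j)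
    (hsep : ∀ j k, j < k → t₀ j + r < t₀ k - r) (hT : ∀ j, t₀ j + r < T)
    (hφ₁ : ∀ j, |φ₁ j - (((t₀ j - r) / 2) * Real.log ((t₀ j - r) / (2 * π)) - (t₀ j - r) / 2 - π / 8)|
      + 2 * stirlingVertRate (1 / 4) / (t₀ j - r) < π / 2)
    (hφ₂ : ∀ j, |φ₂ j - (((t₀ j + r) / 2) * Real.log ((t₀ j + r) / (2 * π)) - (t₀ j + r) / 2 - π / 8)|
      + 2 * stirlingVertRate (1 / 4) / (t₀ j + r) < π / 2)
    (hsign : ∀ j,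
      ((cexp (φ₁ j * I) * (riemannZeta (1 / 2 + t₀ j * I) -
            r * I * deriv riemannZeta (1 / 2 + t₀ j * I))).re < -(2 * (t₀ j + 15) ^ 3 * r ^ 2) ∧
        2 * (t₀ j + 15) ^ 3 * r ^ 2 < (cexp (φ₂ j * I) * (riemannZeta (1 / 2 + t₀ j * I) +
            r * I * deriv riemannZeta (1 / 2 + t₀ j * I))).re) ∨
      (2 * (t₀ j + 15) ^ 3 * r ^ 2 < (cexp (φ₁ j * I) * (riemannZeta (1 / 2 + t₀ j * I) -
            r * I * deriv riemannZeta (1 / 2 + t₀ j * I))).re ∧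
        (cexp (φ₂ j * I) * (riemannZeta (1 / 2 + t₀ j * I) +
            r * I * deriv riemannZeta (1 / 2 + t₀ j * I))).re < -(2 * (t₀ j + 15) ^ 3 * r ^ 2)))
    (hT₁ : 2515 < T) (hT₂ : T < 2516) (hP : HPieces riemannZeta T (1 / 2) ((x₁, d₁) :: L))
    (hlast : piecesLast x₁ L = 2) (hdir : piecesLastDir d₁ L = 0)
    (hcount : |(T / 2 * Real.log (T / (2 * π)) - T / 2 - π / 8) / π + 1 -
        (piecesTurns d₁ L : ℝ) / 2 - n| + 2 * stirlingVertRate (1 / 4) / (π * T) ≤ 1 / 2)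
    {y₁ y₂ : ℝ}
    (h₁ : ∀ γ : Fin n → ℝ, (∀ j, t₀ j - r ≤ γ j ∧ γ j ≤ t₀ j + r) → (1.06 : ℝ) <
      ∑ j : Fin n, 2 * (inghamTerm (fun t : ℝ => (jurkatPeyerimhoffKernel (t / T) : ℂ)) y₁ (γ j)).re)
    (h₂ : ∀ γ : Fin n → ℝ, (∀ j, t₀ j - r ≤ γ j ∧ γ j ≤ t₀ j + r) →
      ∑ j : Fin n, 2 * (inghamTerm (fun t : ℝ => (jurkatPeyerimhoffKernel (t / T) : ℂ)) y₂ (γ j)).re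
        < -1.009) :
    OdlyzkoTeRiele1985_table3 := by
  have hB := ZeroBracketing.of_center hr hr2 h8 hsep hT hφ₁ hφ₂ hsign
  have hN : zetaZeroCount T = n :=
    MertensZeroCertificate.zetaZeroCount_eq_of_hpieces_stirling (by linarith) hP hlast hdir hcount
  exact hB.table3_of_bounds hT₁ hT₂ hN.le h₁ h₂

end Assembly

end Literature.NumberTheory.LFunctions

end
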